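import Literature.Analysis.FluidPDE.LerayHopf
import Literature.Analysis.FluidPDE.SuitableWeak
import Literature.Analysis.FunctionSpaces.WeakLp
import HarnessLib

/-!
# Barker–Prange 2021, §4: effective regularity criteria and the number of singular points in a
# Type-I blow-up scenario

Topic `Analysis/FluidPDE`. Source: T. Barker, C. Prange, *Quantitative regularity for the
Navier–Stokes equations via spatial concentration*, Comm. Math. Phys. 385 (2021) 717–792 =
arXiv:2003.06717 [`BarkerPrange2021`]; read in the arXiv version (held text
`paper:arxiv-2003.06717`), §4 "Further applications" (pp. 24–25: **Proposition 7**,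
**Proposition 8**, **Corollary 9**, **Proposition 10**, arXiv numbering) and §1.4.3–1.4.4 (p. 9:
the class of *suitable finite-energy solutions*, the Lorentz quasi-norm). Companion of
`BarkerPrange2021QuantitativeRates.lean` (§1: Thms 1–2, Cor 1); one file per section (D-0064).

## The printed statements (unit viscosity, no force; `(u,p)` a suitable finite-energy solution)

* §1.4.3: "`u` is a suitable finite-energy solution … on `ℝ³ × (T₁,T)` if it is a solution to (NSE)
  in the sense of distributions and `u ∈ C_w([T₁,T]; L²_σ(ℝ³)) ∩ L²_t(T₁,T; Ḣ¹(ℝ³))`, it satisfies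
  the global energy inequality `‖u(·,t)‖₂² + 2∫_{T₁}^t ∫ |∇u|² ≤ ‖u(·,T₁)‖₂²` for all `t ∈ [T₁,T]`,
  `(u,p)` is a suitable weak solution on `B₁(x) × (T₁,T)` for all `x ∈ ℝ³`."
* **Proposition 7** (§4.1). "For all `M ∈ [1,∞)` sufficiently large the following result holds true.
  Consider a suitable finite-energy solution `(u,p)` … on `ℝ³ × [−1,0]` that satisfies the Type I
  bound `‖u‖_{L^∞_t L^{3,∞}_x(ℝ³ × (−1,0))} ≤ M`. Assume
  `limsup_{r→0} ‖u(·,T*)‖_{L^{3,∞}(B_0(r))} ≤ exp(−exp(M^{1023}))`. Then, `(0,T*)` is a regular point."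
  (Here `T* = 0` is the final time: the proof opens "assume … that `(0,0)` is a singular point".)
* **Proposition 8** (§4.2; "a variant of Theorem 1 in [CWY19] and Proposition 1.3 in
  [seregin2019note]"). "Let `M ∈ [1,∞)` be sufficiently large and define
  `ε(M) := exp(−4exp(M^{1023}))`. For all suitable finite-energy solutions `(u,p)` … on `ℝ³ × [−1,0]`
  that satisfy the Type I bound `‖u‖_{L^∞_t L^{3,∞}_x(ℝ³ × (−1,0))} ≤ M`, the following result holds.
  Let `x₀ ∈ ℝ³`. Assume that there exists `r ∈ (0, exp(M^{1021}))`,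
  `|B_{x₀}(r)|⁻¹ |{x ∈ B_{x₀}(r) : |u(x,0)| ≥ ε(M)/r}| ≤ ε(M)`. Then `(x₀,0)` is a regular
  space-time point."
* **Corollary 9** (§4.2). "Let `T* ∈ (0,∞)` and `M ∈ [1,∞)` be sufficiently large. Assume that `(u,p)`
  is a suitable finite-energy solution … on `ℝ³ × [0,T*]` that satisfies the Type I bound
  `‖u‖_{L^∞_t L^{3,∞}_x(ℝ³ × (0,T*))} ≤ M`. Then `u` has at most `exp(exp(M^{1024}))` blow-up points at
  time `T*`."
* **Proposition 10** (§4.3; "a non-effective version … is in [AlbrittonBarkerBesov2018]"). "For all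
  sufficiently large `M ∈ [1,∞)`, we define `M♭` by [the display of Theorem 2,
  `M♭ = exp(L_* M⁵/2)`]. Let `(u,p)` be a
  suitable finite-energy solution … on `ℝ³ × [−1,0]`. Assume that `‖u(·,−1)‖_{L³(ℝ³)} ≤ M`. If
  `‖u(·,0)‖_{L³(B_0(exp((M♭)^{1221})) ∖ B_0(1))} ≤ exp(−exp((M♭)^{1223}))`, then `(0,0)` is a regular
  point."

## Contents (named facts, D-0014)

* `barkerPrange2021_typeI_regular_of_small_weakL3` — Proposition 7.
* `barkerPrange2021_typeI_regular_of_sparse_profile` — Proposition 8.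
* `barkerPrange2021_typeI_card_singular_points` — Corollary 9.
* `barkerPrange2021_regular_of_relative_smallness` — Proposition 10.

## Transcription notes (never stronger than print)

* *Class.* "Suitable finite-energy solution on `ℝ³ × [T₁,T]`" = the tree's Leray–Hopf class
  `IsLerayHopfOn T ν 0 u₀ u` on `[0,T]` (weak solution; `u ∈ L^∞_t L²`, every slice in `L²`; weak
  gradient in `L²_{t,x}`; the energy inequality from the initial time for every `t ∈ [0,T]` and from
  a.e. time; weak `L²` continuity on `(0,T]`, so the final slice `u T` is the weak-`L²` limit — the
  printed `u(·,T*)` of `C_w([T₁,T]; L²_σ)`; strong attainment of the datum `u₀`, the printed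
  `u(·,T₁)`) together with `IsSuitableWeakSolutionOn` on the whole open slab `(0,T) × ℝ³` (which
  contains every `B₁(x) × (0,T)`). Both tree predicates are at least as strong as the printed
  requirements, so every fact below is implied by print.
* *Type I bound* `‖u‖_{L^∞_t L^{3,∞}_x} ≤ M`: `eWeakLpPow (u t) 3 volume ≤ (ofReal M)³` at every
  `t ∈ (0,T)` (`‖g‖_{L^{3,∞}} = sup_α α d_g(α)^{1/3}`, §1.4.4; the ess-sup in time is imposed at every
  time, a stronger hypothesis). The localized quasi-norm `‖g‖_{L^{3,∞}(Ω)}` uses `d_{g,Ω}`, i.e.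
  `eWeakLpPow g 3 (volume.restrict Ω)`.
* *Regular / singular (blow-up) points* of a solution living on `[0,T]`, at the final time: in the
  sense of Barker–Prange 2020, p. 4 (backward cylinders `Q_{(x,t)}(r) = B_r(x) × (t − r², t)`,
  §1.4.2): `(T,x)` is regular iff `uncurry u` is essentially bounded on some
  `parabolicCylinder r (T,x) = (T − r², T) × B_r(x)`, `r > 0`; singular iff essentially unbounded on
  every such cylinder with `0 < r`, `r² < T` (the convention of `BarkerPrange2020_thm2`;
  "all `r`" and "all small `r`" agree by monotonicity).
* *Prop 7's `limsup`.* `r ↦ ‖u(·,T)‖_{L^{3,∞}(B_0(r))}` is monotone, so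
  `limsup_{r→0} (…) ≤ ε` iff for every `η > ε` some ball has `‖u(·,T)‖_{L^{3,∞}(B_0(r))} ≤ η`; the
  latter is recorded.
* *Prop 8's density hypothesis* is recorded with Lebesgue measure on `ℝ³`:
  `volume {x ∈ B_{x₀}(r) | ε/r ≤ |u(T,x)|} ≤ ε · volume (B_{x₀}(r))`.
* *Cor 9's count*: the blow-up points at time `T` lie in a finite set of cardinality
  `≤ exp(exp(M^{1024}))` (a `Finset` with real-valued cardinality bound).
* *Prop 10's `M♭`* is `exp(L M⁵/2)` for a universal `L = L_* > 0` (the constant of Thm 2);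
  recorded with its own existential `L` so that this file does not depend on the §1 file.
* *Viscosity, time origin, scaling.* Printed for `ν = 1` on `[−1,0]` (Props 7, 8, 10) and `[0,T*]`
  (Cor 9). Recorded on the tree's Leray–Hopf frame `[0,T]`, `T > 0`, for every `ν > 0`: first the
  Navier–Stokes scaling `w(y,s) = λu(x₀ + λy, T + λ²s)`, `λ = √T` (unit viscosity; maps `[0,T]` onto
  `[−1,0]`, preserves the class, the Type I bound, `L³` norms and the density quotient of Prop 8, turns
  the radius range `r ∈ (0, e^{M^{1021}})` into `(0, √T e^{M^{1021}})`, the threshold `ε/r` into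
  `ε/r`, and the annulus `1 ≤ |y| < e^{(M♭)^{1221}}` into `√T ≤ |x| < √T e^{(M♭)^{1221}}`), then
  `w(y,s) = ν⁻¹u(y,s/ν)` for the viscosity (all `L³`/`L^{3,∞}` bounds and thresholds acquire the
  factor `ν`, lengths the factor `√ν` through `√(νT)`; regular and singular points are unchanged since
  the two families of backward cylinders are mutually cofinal) — the conventions of
  `BarkerPrange2020_thm2` and of the §1 file.
* Not here: the proofs (§4 with §3's Carleman machinery), the non-effective originals (Choe–Wolf–Yang
  2019, Thm 1; Seregin 2019, Prop 1.3; Albritton–Barker 2019), Thms 1–2 / Cor 1 (§1 file).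

## Mathlib / tree search

`lean search 'ChoeWolfYang|number of singular points|sparse_profile|relative_smallness|BarkerPrange2021'`:
no transcription of §4 (2026-08-26); the finiteness of the singular set at a Type-I blow-up time
is used informally by N0 crux texts (EnstrophyQuarterLaw birth) without a decl. Reused:
`IsLerayHopfOn` (`LerayHopf.lean`), `IsSuitableWeakSolutionOn`, `slab`, `parabolicCylinder`
(`SuitableWeak.lean`, `WeakSolution.lean`), `FunctionSpaces.eWeakLpPow` (`WeakLp.lean`). Mathlib has
no Navier–Stokes or Lorentz-space notions.

## References

* T. Barker, C. Prange, Comm. Math. Phys. 385 (2021) 717–792 = arXiv:2003.06717: §1.4 p. 9, §4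
  pp. 24–25 (Props 7, 8, 10, Cor 9). [`BarkerPrange2021`]
* T. Barker, C. Prange, ARMA 236 (2020), p. 4 (regular / singular points, backward cylinders).
  [`BarkerPrange2020`]
* H. J. Choe, J. Wolf, M. Yang, Math. Ann. 375 (2019), Thm 1; G. Seregin, *A note on bounded
  scale-invariant quantities for the Navier–Stokes equations* (2019), Prop 1.3 — the non-effective
  versions of Prop 8 / Cor 9 named by the source.
-/

noncomputable section

open MeasureTheory Set Function Metric Filter
open _root_.Topology
open scoped ENNReal

namespace Literature.Analysis.FluidPDE

/-- **Barker–Prange 2021, Proposition 7 (effective regularity from local smallness of the weak-`L³`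
norm at the blow-up time, Type-I case).** There is a universal `M₀ ≥ 1` such that for all
`M ≥ M₀`, every `ν > 0` and `T > 0`: if `(u,p)` is a suitable finite-energy (Leray–Hopf and suitable
weak) solution of the unforced Navier–Stokes equations with viscosity `ν` on `[0,T] × ℝ³` with the
**Type I bound** `‖u(t)‖_{L^{3,∞}} ≤ νM` for `0 < t < T`, and the final slice satisfies
`limsup_{r→0} ‖u(·,T)‖_{L^{3,∞}(B_0(r))} ≤ ν exp(−exp(M^{1023}))` (recorded: for every
`η > exp(−exp(M^{1023}))` some ball `B_0(r)`, `r > 0`, has `‖u(·,T)‖_{L^{3,∞}(B_0(r))} ≤ νη`), then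
`(T, 0)` is a **regular point**: `u` is essentially bounded on some backward cylinder
`(T − r², T) × B_r(0)`. Printed for `ν = 1` on `ℝ³ × [−1,0]`; general frame by scaling (module
docstring). [cite: BarkerPrange2021, Prop. 7 (arXiv:2003.06717 §4.1 p. 24)] -/
def barkerPrange2021_typeI_regular_of_small_weakL3 : Prop :=
  ∃ M₀ : ℝ, 1 ≤ M₀ ∧ ∀ M : ℝ, M₀ ≤ M → ∀ (ν T : ℝ), 0 < ν → 0 < T →
    ∀ (u₀ : EuclideanSpace ℝ (Fin 3) → EuclideanSpace ℝ (Fin 3))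
      (u : ℝ → EuclideanSpace ℝ (Fin 3) → EuclideanSpace ℝ (Fin 3))
      (p : ℝ → EuclideanSpace ℝ (Fin 3) → ℝ),
      IsLerayHopfOn T ν 0 u₀ u →
      IsSuitableWeakSolutionOn (slab (EuclideanSpace ℝ (Fin 3)) (Ioo 0 T) isOpen_Ioo) ν 0 u p →
      (∀ t ∈ Ioo 0 T,
        FunctionSpaces.eWeakLpPow (u t) 3 volume ≤ ENNReal.ofReal (ν * M) ^ (3 : ℕ)) →
      (∀ η : ℝ, Real.exp (-Real.exp (M ^ (1023 : ℕ))) < η → ∃ r : ℝ, 0 < r ∧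
        FunctionSpaces.eWeakLpPow (u T) 3
            (volume.restrict (ball (0 : EuclideanSpace ℝ (Fin 3)) r)) ≤
          ENNReal.ofReal (ν * η) ^ (3 : ℕ)) →
      ∃ r : ℝ, 0 < r ∧
        eLpNorm (uncurry u) ∞
          (volume.restrict (parabolicCylinder r (T, (0 : EuclideanSpace ℝ (Fin 3))))) < ∞

/-- **Barker–Prange 2021, Proposition 8 (effective Choe–Wolf–Yang / Seregin criterion: a sparse
profile at the final time at one admissible scale gives regularity, Type-I case).** There is a
universal `M₀ ≥ 1` such that for all `M ≥ M₀`, with `ε = ε(M) = exp(−4exp(M^{1023}))`, every `ν > 0`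
and `T > 0`: if `(u,p)` is a suitable finite-energy (Leray–Hopf and suitable weak) solution of the
unforced Navier–Stokes equations with viscosity `ν` on `[0,T] × ℝ³` with the Type I bound
`‖u(t)‖_{L^{3,∞}} ≤ νM` for `0 < t < T`, `x₀ ∈ ℝ³`, and at some scale `0 < r < √(νT) exp(M^{1021})`
the super-level set of the final slice is sparse,
`|{x ∈ B_{x₀}(r) : |u(T,x)| ≥ νε/r}| ≤ ε |B_{x₀}(r)|`, then `(T, x₀)` is a regular point (`u`
essentially bounded on some backward cylinder `(T − ρ², T) × B_ρ(x₀)`). Printed for `ν = 1` on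
`ℝ³ × [−1,0]` with `r ∈ (0, exp(M^{1021}))` and threshold `ε(M)/r`; general frame by scaling (module
docstring). [cite: BarkerPrange2021, Prop. 8 (arXiv:2003.06717 §4.2 p. 24)] -/
def barkerPrange2021_typeI_regular_of_sparse_profile : Prop :=
  ∃ M₀ : ℝ, 1 ≤ M₀ ∧ ∀ M : ℝ, M₀ ≤ M → ∀ (ν T : ℝ), 0 < ν → 0 < T →
    ∀ (u₀ : EuclideanSpace ℝ (Fin 3) → EuclideanSpace ℝ (Fin 3))
      (u : ℝ → EuclideanSpace ℝ (Fin 3) → EuclideanSpace ℝ (Fin 3))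
      (p : ℝ → EuclideanSpace ℝ (Fin 3) → ℝ),
      IsLerayHopfOn T ν 0 u₀ u →
      IsSuitableWeakSolutionOn (slab (EuclideanSpace ℝ (Fin 3)) (Ioo 0 T) isOpen_Ioo) ν 0 u p →
      (∀ t ∈ Ioo 0 T,
        FunctionSpaces.eWeakLpPow (u t) 3 volume ≤ ENNReal.ofReal (ν * M) ^ (3 : ℕ)) →
      ∀ x₀ : EuclideanSpace ℝ (Fin 3),
        (∃ r : ℝ, 0 < r ∧ r < Real.sqrt (ν * T) * Real.exp (M ^ (1021 : ℕ)) ∧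
          volume {x ∈ ball x₀ r |
              ν * Real.exp (-4 * Real.exp (M ^ (1023 : ℕ))) / r ≤ ‖u T x‖} ≤
            ENNReal.ofReal (Real.exp (-4 * Real.exp (M ^ (1023 : ℕ)))) * volume (ball x₀ r)) →
        ∃ ρ : ℝ, 0 < ρ ∧
          eLpNorm (uncurry u) ∞ (volume.restrict (parabolicCylinder ρ (T, x₀))) < ∞

/-- **Barker–Prange 2021, Corollary 9 (effective bound on the number of blow-up points in a Type-I
scenario).** There is a universal `M₀ ≥ 1` such that for all `M ≥ M₀`, every `ν > 0` and `T > 0`: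
if `(u,p)` is a suitable finite-energy (Leray–Hopf and suitable weak) solution of the unforced
Navier–Stokes equations with viscosity `ν` on `[0,T] × ℝ³` with the Type I bound
`‖u(t)‖_{L^{3,∞}} ≤ νM` for `0 < t < T`, then `u` has at most `exp(exp(M^{1024}))` blow-up points at
time `T`: there is a finite set `F ⊂ ℝ³` with `#F ≤ exp(exp(M^{1024}))` containing every `x` such
that `(T,x)` is singular (`u` essentially unbounded on every backward cylinder
`(T − r², T) × B_r(x)`, `0 < r`, `r² < T`). Effective version of Choe–Wolf–Yang 2019 and Seregin
2019 (finitely many singular points at a Type-I blow-up time). Printed for `ν = 1` on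
`ℝ³ × [0,T*]`; general `ν` by `w(y,s) = ν⁻¹u(y,s/ν)` (module docstring). [cite: BarkerPrange2021, Cor. 9 (arXiv:2003.06717 §4.2 p. 24)] -/
def barkerPrange2021_typeI_card_singular_points : Prop :=
  ∃ M₀ : ℝ, 1 ≤ M₀ ∧ ∀ M : ℝ, M₀ ≤ M → ∀ (ν T : ℝ), 0 < ν → 0 < T →
    ∀ (u₀ : EuclideanSpace ℝ (Fin 3) → EuclideanSpace ℝ (Fin 3))
      (u : ℝ → EuclideanSpace ℝ (Fin 3) → EuclideanSpace ℝ (Fin 3))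
      (p : ℝ → EuclideanSpace ℝ (Fin 3) → ℝ),
      IsLerayHopfOn T ν 0 u₀ u →
      IsSuitableWeakSolutionOn (slab (EuclideanSpace ℝ (Fin 3)) (Ioo 0 T) isOpen_Ioo) ν 0 u p →
      (∀ t ∈ Ioo 0 T,
        FunctionSpaces.eWeakLpPow (u t) 3 volume ≤ ENNReal.ofReal (ν * M) ^ (3 : ℕ)) →
      ∃ F : Finset (EuclideanSpace ℝ (Fin 3)),
        (F.card : ℝ) ≤ Real.exp (Real.exp (M ^ (1024 : ℕ))) ∧
        ∀ x : EuclideanSpace ℝ (Fin 3),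
          (∀ r : ℝ, 0 < r → r ^ 2 < T →
            eLpNorm (uncurry u) ∞ (volume.restrict (parabolicCylinder r (T, x))) = ∞) →
          x ∈ F

/-- **Barker–Prange 2021, Proposition 10 (effective regularity from the relative smallness of the
`L³` norm at the final time).** There are universal `M₀ ≥ 1` and `L = L_* > 0` such that for all
`M ≥ M₀`, with `M♭ = exp(L M⁵/2)`, every `ν > 0` and `T > 0`: if `(u,p)` is a suitable finite-energy
(Leray–Hopf and suitable weak) solution of the unforced Navier–Stokes equations with viscosity `ν`
on `[0,T] × ℝ³` from a datum with `‖u₀‖_{L³} ≤ νM`, and the final slice is small on the annulus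
`√(νT) ≤ |x| < √(νT) exp((M♭)^{1221})`, `‖u(·,T)‖_{L³(annulus)} ≤ ν exp(−exp((M♭)^{1223}))`, then
`(T, 0)` is a regular point (`u` essentially bounded on some backward cylinder
`(T − r², T) × B_r(0)`). Printed for `ν = 1` on `ℝ³ × [−1,0]` with `‖u(·,−1)‖_{L³} ≤ M` and the
annulus `B_0(exp((M♭)^{1221})) ∖ B_0(1)`; general frame by scaling (module docstring). Effective
version of a criterion of Albritton–Barker 2019. [cite: BarkerPrange2021, Prop. 10 (arXiv:2003.06717 §4.3 p. 25)] -/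
def barkerPrange2021_regular_of_relative_smallness : Prop :=
  ∃ M₀ : ℝ, 1 ≤ M₀ ∧ ∃ L : ℝ, 0 < L ∧ ∀ M : ℝ, M₀ ≤ M → ∀ (ν T : ℝ), 0 < ν → 0 < T →
    ∀ (u₀ : EuclideanSpace ℝ (Fin 3) → EuclideanSpace ℝ (Fin 3))
      (u : ℝ → EuclideanSpace ℝ (Fin 3) → EuclideanSpace ℝ (Fin 3))
      (p : ℝ → EuclideanSpace ℝ (Fin 3) → ℝ),
      IsLerayHopfOn T ν 0 u₀ u →
      IsSuitableWeakSolutionOn (slab (EuclideanSpace ℝ (Fin 3)) (Ioo 0 T) isOpen_Ioo) ν 0 u p →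
      eLpNorm u₀ 3 volume ≤ ENNReal.ofReal (ν * M) →
      eLpNorm (u T) 3 (volume.restrict
          {x : EuclideanSpace ℝ (Fin 3) | Real.sqrt (ν * T) ≤ ‖x‖ ∧
            ‖x‖ < Real.sqrt (ν * T) * Real.exp (Real.exp (L * M ^ 5 / 2) ^ (1221 : ℕ))}) ≤
        ENNReal.ofReal (ν * Real.exp (-Real.exp (Real.exp (L * M ^ 5 / 2) ^ (1223 : ℕ)))) →
      ∃ r : ℝ, 0 < r ∧
        eLpNorm (uncurry u) ∞
          (volume.restrict (parabolicCylinder r (T, (0 : EuclideanSpace ℝ (Fin 3))))) < ∞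

end Literature.Analysis.FluidPDE

end
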